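import Mathlib
import HarnessLib
import Literature.Probability.ImportanceSampling.ChatterjeeDiaconis
import Summits.Ventures.LatticeQCDFlow.Scaling.VarianceLaws

/-!
# JarzynskiSampleSize — Chatterjee–Diaconis on the path space of a finite NE-MCMC protocol: the
# Jarzynski / reweighting estimators from `N` forward evolutions need `N ≈ exp D(P̃_R ‖ P_F)`,
# `D(P̃_R ‖ P_F) = ΔF − ⟨W⟩_R̃` (the dissipation of the REVERSE process)

HONEST FRAMING: exact (Metropolis-corrected) sampling algorithms for lattice gauge theory;
figures of merit are autocorrelation/cost numbers at stated couplings and volumes; no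
continuum-physics claim.

Venture `LatticeQCDFlow` (cell pub-lqcd), topic `Scaling`; FANOUT row 19 (`su2-snf`, GEN-7).
A DOCKING file: the theorem is the Literature's **Chatterjee–Diaconis sample-size theorem**
(`Literature/Probability/ImportanceSampling/ChatterjeeDiaconis`, Ann. Appl. Probab. 28 (2018)
Thm 1.1, PROVED there: importance sampling of `ν` from `μ` needs `n ≈ exp D(ν‖μ)` draws), applied
— not re-proved — to the finite path space of `Exactness/JarzynskiFinite` /
`Scaling/StochasticFlows`: proposal `μ = P_F` (the forward path law `pathLaw (gibbsLaw (S 0)) P`),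
target `ν = P̃_R` (the reverse path law read on forward paths, `revPathLaw S P`), likelihood ratio
`ρ = P̃_R/P_F = e^{−(W − ΔF)}` (Crooks, `crooks_pathwise`), so that the importance-sampling estimate
`I_N(f)` of the Literature IS the Jarzynski-reweighted average `(1/N) Σ_i f(ωⁱ) e^{−(W(ωⁱ) − ΔF)}`
of `N` independent forward evolutions, `I_N(1)` is the Jarzynski estimator `Ẑ_N·e^{ΔF}` of `1`,
and the sample-size exponent is `L = D(P̃_R ‖ P_F) = ΔF − ⟨W⟩_R̃`, the mean work DISSIPATED BY THE
REVERSE PROCESS (C. Jarzynski, Phys. Rev. E 73 (2006) 046105, "number of realizations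
`≳ e^{W̄_d^R}`" — NAMED ONLY; here it is a theorem with both directions and explicit tails).
Nothing is cited as a fact; OUR WORK is only the bookkeeping (§1–§2: a finite law as a Mathlib
measure, its Radon–Nikodym derivative, the translation of every integral into a finite sum).

## Content

§1 Finite laws as measures (generic `Ω`, `[Fintype Ω] [MeasurableSpace Ω] [MeasurableSingletonClass Ω]`):
`lawPMF`, `lawMeasure p _ _ = Σ_ω p(ω)·δ_ω` (a probability measure), `lawMeasure_apply_singleton`,
`integral_lawMeasure` (`∫ f = Σ p f`), `lawMeasure_real_apply` (`P(A) = Σ_{ω ∈ A} p ω`),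
`ae_lawMeasure_iff` (full support: a.e. = everywhere), `lawMeasure_eq_withDensity`,
**`rnDeriv_lawMeasure`** (`dν/dμ = q/p` EVERYWHERE), `lawMeasure_absolutelyContinuous`.

§2 **Chatterjee–Diaconis for finite laws** (`q > 0` proposal, `p ≥ 0` target, both normalised;
`L = klFin p q = Σ p log(p/q)` = theory-2's forward KL of `Scaling/ImportanceWeights`; the
`N`-sample is `(lawMeasure q)^{⊗N}` on `Fin N → Ω`):
* `isEstimate_lawMeasure` — the Literature's `I_N(f)(x) = (1/N) Σ_i f(x i)·p(x i)/q(x i)`;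
* **`finite_sampleSize_sufficient`** — `N ≥ e^{L+t}` ⇒
  `E|I_N(f) − Σ p f| ≤ √(Σ p f²)·(e^{−t/4} + 2√(P_p(log(p/q) > L + t/2)))`;
* **`finite_sampleSize_necessary`** — `N ≤ e^{L−t}`, `δ ∈ (0,1)` ⇒
  `P^{⊗N}(I_N(1) ≥ 1 − δ) ≤ e^{−t/2} + P_p(log(p/q) ≤ L − t/2)/(1 − δ)`.

§3 **The NE-MCMC / Jarzynski docking** (actions `S : Fin (n+1) → X → ℝ`, positive layers with unit
row sums leaving the intermediate Boltzmann weights invariant; `ΔF = F(S_n) − F(S_0)`;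
`pathMeasure S P _ _` = the forward path law `P_F` as a probability measure on path space):
* `revPathLaw_div_pathLaw` — `P̃_R(ω)/P_F(ω) = e^{−(W(ω) − ΔF)}` (Crooks);
* **`klFin_revPathLaw_pathLaw`** — `D(P̃_R ‖ P_F) = ΔF − ⟨W⟩_R̃`, the reverse dissipation
  (`≥ 0`: `reverseDissipation_nonneg`);
* **`jarzynski_sampleSize_necessary`** — if `N ≤ exp(ΔF − ⟨W⟩_R̃ − t)` then, for `N` independent
  forward evolutions, `P(Ẑ_N e^{ΔF} ≥ 1 − δ) ≤ e^{−t/2} + P̃_R(W ≥ ⟨W⟩_R̃ + t/2)/(1 − δ)`: with too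
  few evolutions the Jarzynski estimator `Ẑ_N = (1/N)Σ e^{−W_i}` falls short of `e^{−ΔF}` by the
  factor `1 − δ` — i.e. `ΔF̂_N = −log Ẑ_N > ΔF − log(1 − δ)` OVER-estimates — except on an event of
  the displayed probability;
* **`jarzynski_sampleSize_sufficient`** — if `N ≥ exp(ΔF − ⟨W⟩_R̃ + t)` then for every path
  functional `f`, `E|(1/N)Σ_i f(ωⁱ)e^{−(W_i − ΔF)} − ⟨f⟩_R̃| ≤ √⟨f²⟩_R̃·(e^{−t/4} + 2√(P̃_R(W <
  ⟨W⟩_R̃ − t/2)))` — the reweighting estimator of any reverse-path (hence any TARGET endpoint)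
  expectation is accurate.

READING (value-free).  The sample-size exponent of NE-MCMC reweighting is the REVERSE dissipation
`ΔF − ⟨W⟩_R̃ = D(P̃_R‖P_F)`, not the forward one `⟨W⟩_F − ΔF = D(P_F‖P̃_R)` that `−log ÊSS` tracks
to leading order; in the Gaussian work model both equal `s/2` (`Scaling/GaussianWorkSampleSize`),
in general they differ.  NOT CLAIMED: the general measurable-space version (row 13's
`Exactness/NCMCGeneralSpace*` Crooks pairs; the Literature theorem applies verbatim there);
correlated (restart-chain) evolutions — the `N` evolutions here are INDEPENDENT draws of the
forward path law, as in the Literature; the sample Kish ESS (`k = 2`).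
-/

namespace Summit.Ventures.LatticeQCDFlow.Theory2

open Finset MeasureTheory
open scoped ENNReal
open Literature.Probability.ImportanceSampling (isEstimate ChatterjeeDiaconis2018_sampleSize_holds)
open Literature.Probability.MarkovChains (IsRowStochastic IsStationary)
open Summit.Ventures.LatticeQCDFlow.Exactness

/-! ## §1 Finite laws as measures -/

section FiniteLaw

variable {Ω : Type*} [Fintype Ω]

/-- `Σ_ω ofReal (p ω) = 1` for a non-negative normalised `p`. -/
theorem sum_ofReal_eq_one {p : Ω → ℝ} (hp : ∀ ω, 0 ≤ p ω) (hp1 : ∑ ω, p ω = 1) :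
    ∑ ω, ENNReal.ofReal (p ω) = 1 := by
  rw [← ENNReal.ofReal_sum_of_nonneg (fun ω _ => hp ω), hp1, ENNReal.ofReal_one]

/-- A non-negative normalised `p : Ω → ℝ` on a finite type as a Mathlib `PMF`. -/
noncomputable def lawPMF (p : Ω → ℝ) (hp : ∀ ω, 0 ≤ p ω) (hp1 : ∑ ω, p ω = 1) : PMF Ω :=
  PMF.ofFintype (fun ω => ENNReal.ofReal (p ω)) (sum_ofReal_eq_one hp hp1)

variable [MeasurableSpace Ω] [MeasurableSingletonClass Ω]

/-- A non-negative normalised `p : Ω → ℝ` on a finite type as a probability MEASURE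
`Σ_ω p(ω)·δ_ω` (the law of ONE draw; `N` independent draws are `Measure.pi`). -/
noncomputable def lawMeasure (p : Ω → ℝ) (hp : ∀ ω, 0 ≤ p ω) (hp1 : ∑ ω, p ω = 1) : Measure Ω :=
  (lawPMF p hp hp1).toMeasure

/-- `lawMeasure` is a probability measure. -/
instance lawMeasure.isProbabilityMeasure (p : Ω → ℝ) (hp : ∀ ω, 0 ≤ p ω)
    (hp1 : ∑ ω, p ω = 1) : IsProbabilityMeasure (lawMeasure p hp hp1) := by
  unfold lawMeasure; infer_instance

/-- Mass of a point: `lawMeasure p {a} = p a`. -/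
theorem lawMeasure_apply_singleton (p : Ω → ℝ) (hp : ∀ ω, 0 ≤ p ω) (hp1 : ∑ ω, p ω = 1)
    (a : Ω) : lawMeasure p hp hp1 {a} = ENNReal.ofReal (p a) := by
  rw [lawMeasure, PMF.toMeasure_apply_singleton _ _ (measurableSet_singleton a), lawPMF,
    PMF.ofFintype_apply]

/-- **Integrals are finite sums**: `∫ f d(lawMeasure p) = Σ_ω p(ω) f(ω)`. -/
theorem integral_lawMeasure (p : Ω → ℝ) (hp : ∀ ω, 0 ≤ p ω) (hp1 : ∑ ω, p ω = 1) (f : Ω → ℝ) :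
    ∫ ω, f ω ∂(lawMeasure p hp hp1) = ∑ ω, p ω * f ω := by
  rw [lawMeasure, PMF.integral_eq_sum]
  refine Finset.sum_congr rfl fun ω _ => ?_
  rw [lawPMF, PMF.ofFintype_apply, ENNReal.toReal_ofReal (hp ω), smul_eq_mul]

/-- **Probabilities are finite sums**: `P(A) = Σ_ω 1_A(ω) p(ω)`. -/
theorem lawMeasure_real_apply (p : Ω → ℝ) (hp : ∀ ω, 0 ≤ p ω) (hp1 : ∑ ω, p ω = 1)
    (A : Set Ω) [DecidablePred (· ∈ A)] :
    (lawMeasure p hp hp1 A).toReal = ∑ ω, if ω ∈ A then p ω else 0 := by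
  rw [lawMeasure, PMF.toMeasure_apply_fintype, ENNReal.toReal_sum (fun ω _ => ?_)]
  · refine Finset.sum_congr rfl fun ω _ => ?_
    by_cases hω : ω ∈ A
    · rw [Set.indicator_of_mem hω, if_pos hω, lawPMF, PMF.ofFintype_apply,
        ENNReal.toReal_ofReal (hp ω)]
    · rw [Set.indicator_of_notMem hω, if_neg hω, ENNReal.toReal_zero]
  · exact (Set.indicator_le_self _ _ ω).trans_lt (by rw [lawPMF, PMF.ofFintype_apply]; simp) |>.ne

/-- Under a law of FULL support, almost everywhere is everywhere. -/
theorem ae_lawMeasure_iff {p : Ω → ℝ} (hp : ∀ ω, 0 < p ω) (hp1 : ∑ ω, p ω = 1) {P : Ω → Prop} :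
    (∀ᵐ ω ∂(lawMeasure p (fun ω => (hp ω).le) hp1), P ω) ↔ ∀ ω, P ω := by
  constructor
  · intro h ω
    rw [ae_iff, lawMeasure, PMF.toMeasure_apply_eq_zero_iff _ (MeasurableSet.of_discrete),
      lawPMF, PMF.support_ofFintype] at h
    by_contra hω
    have hmem : ω ∈ Function.support (fun ω => ENNReal.ofReal (p ω)) := by
      rw [Function.mem_support]; exact (ENNReal.ofReal_pos.mpr (hp ω)).ne'
    exact Set.disjoint_left.mp h hmem hω
  · exact fun h => Filter.Eventually.of_forall h

/-- A second law is the first TILTED by the ratio: `law q = (law p)·(q/p)` for `p > 0`. -/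
theorem lawMeasure_eq_withDensity {p q : Ω → ℝ} (hp : ∀ ω, 0 < p ω) (hp1 : ∑ ω, p ω = 1)
    (hq : ∀ ω, 0 ≤ q ω) (hq1 : ∑ ω, q ω = 1) :
    lawMeasure q hq hq1
      = (lawMeasure p (fun ω => (hp ω).le) hp1).withDensity
          (fun ω => ENNReal.ofReal (q ω / p ω)) := by
  refine Measure.ext_of_singleton fun a => ?_
  rw [lawMeasure_apply_singleton, withDensity_apply _ (measurableSet_singleton a),
    lintegral_singleton, lawMeasure_apply_singleton,
    ← ENNReal.ofReal_mul (div_nonneg (hq a) (hp a).le), div_mul_cancel₀ _ (hp a).ne']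

/-- **The Radon–Nikodym derivative IS the likelihood ratio, at every point** (full support). -/
theorem rnDeriv_lawMeasure {p q : Ω → ℝ} (hp : ∀ ω, 0 < p ω) (hp1 : ∑ ω, p ω = 1)
    (hq : ∀ ω, 0 ≤ q ω) (hq1 : ∑ ω, q ω = 1) (ω : Ω) :
    (lawMeasure q hq hq1).rnDeriv (lawMeasure p (fun ω => (hp ω).le) hp1) ω
      = ENNReal.ofReal (q ω / p ω) := by
  have h := Measure.rnDeriv_withDensity (lawMeasure p (fun ω => (hp ω).le) hp1)
    (f := fun ω => ENNReal.ofReal (q ω / p ω)) (Measurable.of_discrete)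
  rw [← lawMeasure_eq_withDensity hp hp1 hq hq1] at h
  exact (ae_lawMeasure_iff hp hp1).mp h ω

/-- In `ℝ`: `(dν/dμ)(ω) = q(ω)/p(ω)`. -/
theorem toReal_rnDeriv_lawMeasure {p q : Ω → ℝ} (hp : ∀ ω, 0 < p ω) (hp1 : ∑ ω, p ω = 1)
    (hq : ∀ ω, 0 ≤ q ω) (hq1 : ∑ ω, q ω = 1) (ω : Ω) :
    ((lawMeasure q hq hq1).rnDeriv (lawMeasure p (fun ω => (hp ω).le) hp1) ω).toReal
      = q ω / p ω := by
  rw [rnDeriv_lawMeasure hp hp1 hq hq1, ENNReal.toReal_ofReal (div_nonneg (hq ω) (hp ω).le)]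

/-- Absolute continuity `law q ≪ law p` for `p > 0`. -/
theorem lawMeasure_absolutelyContinuous {p q : Ω → ℝ} (hp : ∀ ω, 0 < p ω) (hp1 : ∑ ω, p ω = 1)
    (hq : ∀ ω, 0 ≤ q ω) (hq1 : ∑ ω, q ω = 1) :
    lawMeasure q hq hq1 ≪ lawMeasure p (fun ω => (hp ω).le) hp1 := by
  rw [lawMeasure_eq_withDensity hp hp1 hq hq1]
  exact withDensity_absolutelyContinuous _ _

/-- Every real function on a finite probability space is in `L²`. -/
theorem memLp_two_lawMeasure (p : Ω → ℝ) (hp : ∀ ω, 0 ≤ p ω) (hp1 : ∑ ω, p ω = 1) (f : Ω → ℝ) :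
    MemLp f 2 (lawMeasure p hp hp1) := by
  refine MemLp.of_bound (Measurable.of_discrete).aestronglyMeasurable (∑ ω, |f ω|)
    (Filter.Eventually.of_forall fun ω => ?_)
  rw [Real.norm_eq_abs]
  exact Finset.single_le_sum (fun ω _ => abs_nonneg (f ω)) (Finset.mem_univ ω)

end FiniteLaw

/-! ## §2 Chatterjee–Diaconis for finite laws -/

section FiniteCD

variable {Ω : Type*} [Fintype Ω] [MeasurableSpace Ω] [MeasurableSingletonClass Ω]

/-- The Literature's importance-sampling estimate from an `N`-sample `x`, read with finite laws:
`I_N(f)(x) = (1/N) Σ_i f(x i)·p(x i)/q(x i)`. -/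
theorem isEstimate_lawMeasure {p q : Ω → ℝ} (hq : ∀ ω, 0 < q ω) (hq1 : ∑ ω, q ω = 1)
    (hp : ∀ ω, 0 ≤ p ω) (hp1 : ∑ ω, p ω = 1) (f : Ω → ℝ) (N : ℕ) (x : Fin N → Ω) :
    isEstimate (lawMeasure q (fun ω => (hq ω).le) hq1) (lawMeasure p hp hp1) f N x
      = (1 / (N : ℝ)) * ∑ i, f (x i) * (p (x i) / q (x i)) := by
  unfold isEstimate
  congr 1
  exact Finset.sum_congr rfl fun i _ => by rw [toReal_rnDeriv_lawMeasure hq hq1 hp hp1]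

/-- The Literature's `L = ∫ log ρ dν` is theory-2's finite forward KL `klFin p q = Σ p log(p/q)`. -/
theorem integral_log_rnDeriv_lawMeasure {p q : Ω → ℝ} (hq : ∀ ω, 0 < q ω) (hq1 : ∑ ω, q ω = 1)
    (hp : ∀ ω, 0 ≤ p ω) (hp1 : ∑ ω, p ω = 1) :
    ∫ ω, Real.log ((lawMeasure p hp hp1).rnDeriv (lawMeasure q (fun ω => (hq ω).le) hq1) ω).toReal
        ∂(lawMeasure p hp hp1)
      = klFin p q := by
  simp_rw [toReal_rnDeriv_lawMeasure hq hq1 hp hp1]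
  rw [integral_lawMeasure]
  rfl

/-- **CHATTERJEE–DIACONIS, FINITE LAWS, SUFFICIENCY.**  Target `p ≥ 0`, proposal `q > 0` (both
normalised), `L = klFin p q`, `t ≥ 0`, `N ≥ e^{L+t}` independent draws from `q`:
`E|I_N(f) − Σ p f| ≤ √(Σ p f²)·(e^{−t/4} + 2·√(P_p{log(p/q) > L + t/2}))`. -/
theorem finite_sampleSize_sufficient {p q : Ω → ℝ} (hq : ∀ ω, 0 < q ω) (hq1 : ∑ ω, q ω = 1)
    (hp : ∀ ω, 0 ≤ p ω) (hp1 : ∑ ω, p ω = 1) (f : Ω → ℝ) {t : ℝ} (ht : 0 ≤ t) {N : ℕ}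
    (hN : Real.exp (klFin p q + t) ≤ N) :
    ∫ x, |(1 / (N : ℝ)) * ∑ i, f (x i) * (p (x i) / q (x i)) - ∑ ω, p ω * f ω|
        ∂(Measure.pi fun _ : Fin N => lawMeasure q (fun ω => (hq ω).le) hq1)
      ≤ Real.sqrt (∑ ω, p ω * f ω ^ 2) *
          (Real.exp (-t / 4) + 2 * Real.sqrt
            (∑ ω, if klFin p q + t / 2 < Real.log (p ω / q ω) then p ω else 0)) := by
  have hCD := (ChatterjeeDiaconis2018_sampleSize_holds Ω (lawMeasure q (fun ω => (hq ω).le) hq1)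
    (lawMeasure p hp hp1) (lawMeasure_absolutelyContinuous hq hq1 hp hp1) f
    (Measurable.of_discrete) (memLp_two_lawMeasure p hp hp1 f) t ht).1 N
  rw [integral_log_rnDeriv_lawMeasure hq hq1 hp hp1] at hCD
  have h := hCD hN
  simp_rw [isEstimate_lawMeasure hq hq1 hp hp1, integral_lawMeasure,
    toReal_rnDeriv_lawMeasure hq hq1 hp hp1] at h
  rw [lawMeasure_real_apply] at h
  simpa only [Set.mem_setOf_eq] using h

/-- **CHATTERJEE–DIACONIS, FINITE LAWS, NECESSITY.**  `t ≥ 0`, `N ≤ e^{L−t}` independent draws from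
`q`, `δ ∈ (0, 1)`: `P^{⊗N}{I_N(1) ≥ 1 − δ} ≤ e^{−t/2} + P_p{log(p/q) ≤ L − t/2}/(1 − δ)` — with too
few draws the mean weight falls short of its expectation `1` except on an event of that probability. -/
theorem finite_sampleSize_necessary {p q : Ω → ℝ} (hq : ∀ ω, 0 < q ω) (hq1 : ∑ ω, q ω = 1)
    (hp : ∀ ω, 0 ≤ p ω) (hp1 : ∑ ω, p ω = 1) {t : ℝ} (ht : 0 ≤ t) {N : ℕ}
    (hN : (N : ℝ) ≤ Real.exp (klFin p q - t)) {δ : ℝ} (hδ0 : 0 < δ) (hδ1 : δ < 1) :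
    ((Measure.pi fun _ : Fin N => lawMeasure q (fun ω => (hq ω).le) hq1)
        {x | 1 - δ ≤ (1 / (N : ℝ)) * ∑ i, p (x i) / q (x i)}).toReal
      ≤ Real.exp (-t / 2)
          + (∑ ω, if Real.log (p ω / q ω) ≤ klFin p q - t / 2 then p ω else 0) / (1 - δ) := by
  have hCD := (ChatterjeeDiaconis2018_sampleSize_holds Ω (lawMeasure q (fun ω => (hq ω).le) hq1)
    (lawMeasure p hp hp1) (lawMeasure_absolutelyContinuous hq hq1 hp hp1) (fun _ => (1 : ℝ))
    (Measurable.of_discrete) (memLp_two_lawMeasure p hp hp1 _) t ht).2 N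
  rw [integral_log_rnDeriv_lawMeasure hq hq1 hp hp1] at hCD
  have h := hCD hN δ hδ0 hδ1
  simp_rw [isEstimate_lawMeasure hq hq1 hp hp1, toReal_rnDeriv_lawMeasure hq hq1 hp hp1,
    one_mul] at h
  rw [lawMeasure_real_apply] at h
  simpa only [Set.mem_setOf_eq] using h

end FiniteCD

/-! ## §3 The NE-MCMC docking: forward evolutions as the proposal, reverse paths as the target -/

section Jarzynski

variable {X : Type*} [Fintype X] [Nonempty X] [MeasurableSpace X] [MeasurableSingletonClass X]
variable {n : ℕ}

omit [MeasurableSpace X] [MeasurableSingletonClass X] in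
/-- The forward path law sums to one (unit row sums). -/
theorem sum_pathLaw_gibbsLaw_eq_one (S : Fin (n + 1) → X → ℝ) (P : Fin n → X → X → ℝ)
    (hProw : ∀ k x, ∑ y, P k x y = 1) : ∑ ω, pathLaw (gibbsLaw (S 0)) P ω = 1 := by
  rw [sum_pathLaw _ _ hProw, sum_gibbsLaw]

/-- **The forward path law `P_F` of an NE-MCMC protocol as a probability measure on path space**
(the law of ONE forward evolution started in equilibrium at `S 0`). -/
noncomputable def pathMeasure (S : Fin (n + 1) → X → ℝ) (P : Fin n → X → X → ℝ)
    (hProw : ∀ k x, ∑ y, P k x y = 1) (hPpos : ∀ k x y, 0 < P k x y) :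
    Measure (Fin (n + 1) → X) :=
  lawMeasure (pathLaw (gibbsLaw (S 0)) P) (fun ω => (pathLaw_pos (gibbsLaw_pos _) hPpos ω).le)
    (sum_pathLaw_gibbsLaw_eq_one S P hProw)

/-- `pathMeasure` is a probability measure. -/
instance pathMeasure.isProbabilityMeasure (S : Fin (n + 1) → X → ℝ) (P : Fin n → X → X → ℝ)
    (hProw : ∀ k x, ∑ y, P k x y = 1) (hPpos : ∀ k x y, 0 < P k x y) :
    IsProbabilityMeasure (pathMeasure S P hProw hPpos) := by
  unfold pathMeasure; infer_instance

omit [MeasurableSpace X] [MeasurableSingletonClass X] in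
/-- **Crooks as a likelihood ratio**: `P̃_R(ω)/P_F(ω) = e^{−(W(ω) − ΔF)}`, `ΔF = F(S_n) − F(S_0)`. -/
theorem revPathLaw_div_pathLaw (S : Fin (n + 1) → X → ℝ) (P : Fin n → X → X → ℝ)
    (hPpos : ∀ k x y, 0 < P k x y) (ω : Fin (n + 1) → X) :
    revPathLaw S P ω / pathLaw (gibbsLaw (S 0)) P ω
      = Real.exp (-(work S ω - (freeEnergy (S (Fin.last n)) - freeEnergy (S 0)))) := by
  have hc := crooks_pathwise S P ω; have hF := pathLaw_pos (gibbsLaw_pos (S 0)) hPpos ω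
  have hZ0 := partitionFn_pos (S 0); have hZn := partitionFn_pos (S (Fin.last n))
  have hexp : Real.exp (-(work S ω - (freeEnergy (S (Fin.last n)) - freeEnergy (S 0))))
      = Real.exp (-(work S ω)) * (partitionFn (S 0) / partitionFn (S (Fin.last n))) := by
    unfold freeEnergy
    rw [show -(work S ω - (-Real.log (partitionFn (S (Fin.last n))) - -Real.log (partitionFn (S 0))))
        = -(work S ω) + (Real.log (partitionFn (S 0)) - Real.log (partitionFn (S (Fin.last n)))) by
          ring,
      Real.exp_add, ← Real.log_div hZ0.ne' hZn.ne', Real.exp_log (div_pos hZ0 hZn)]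
  have hR : revPathLaw S P ω = pathLaw (gibbsLaw (S 0)) P ω * Real.exp (-(work S ω))
      * partitionFn (S 0) / partitionFn (S (Fin.last n)) := by
    rw [hc]
    field_simp
  rw [hexp, div_eq_iff hF.ne', hR]; ring

omit [MeasurableSpace X] [MeasurableSingletonClass X] in
/-- **`D(P̃_R ‖ P_F) = ΔF − ⟨W⟩_R̃`**: the Kullback–Leibler divergence of the reverse path law from
the forward one — the Chatterjee–Diaconis exponent of NE-MCMC reweighting — is the free-energy
difference minus the mean of the (forward) work functional under the REVERSE path law, i.e. the
mean work dissipated by the reverse process. -/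
theorem klFin_revPathLaw_pathLaw (S : Fin (n + 1) → X → ℝ) (P : Fin n → X → X → ℝ)
    (hPpos : ∀ k x y, 0 < P k x y)
    (hst : ∀ k : Fin n, IsStationary (fun x => Real.exp (-(S k.succ x))) (P k)) :
    klFin (revPathLaw S P) (pathLaw (gibbsLaw (S 0)) P)
      = (freeEnergy (S (Fin.last n)) - freeEnergy (S 0)) - ∑ ω, revPathLaw S P ω * work S ω := by
  unfold klFin
  simp_rw [revPathLaw_div_pathLaw S P hPpos, Real.log_exp, neg_sub, mul_sub, Finset.sum_sub_distrib,
    ← Finset.sum_mul, sum_revPathLaw S P hst, one_mul]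

omit [MeasurableSpace X] [MeasurableSingletonClass X] in
/-- The reverse dissipation is non-negative: `⟨W⟩_R̃ ≤ ΔF` (Gibbs' inequality). -/
theorem reverseDissipation_nonneg (S : Fin (n + 1) → X → ℝ) (P : Fin n → X → X → ℝ)
    (hProw : ∀ k x, ∑ y, P k x y = 1) (hPpos : ∀ k x y, 0 < P k x y)
    (hst : ∀ k : Fin n, IsStationary (fun x => Real.exp (-(S k.succ x))) (P k)) :
    0 ≤ (freeEnergy (S (Fin.last n)) - freeEnergy (S 0)) - ∑ ω, revPathLaw S P ω * work S ω := by
  rw [← klFin_revPathLaw_pathLaw S P hPpos hst]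
  exact klFin_nonneg (revPathLaw_nonneg S fun k x y => (hPpos k x y).le)
    (pathLaw_pos (gibbsLaw_pos _) hPpos)
    (by rw [sum_revPathLaw S P hst, sum_pathLaw_gibbsLaw_eq_one S P hProw])

/-- **JARZYNSKI SAMPLE SIZE, NECESSITY.**  For `N` INDEPENDENT forward evolutions with
`N ≤ exp(ΔF − ⟨W⟩_R̃ − t)` (`t ≥ 0`) and every `δ ∈ (0, 1)`: the Jarzynski estimator
`Ẑ_N = (1/N) Σ_i e^{−W_i}` of `e^{−ΔF}` satisfies `Ẑ_N e^{ΔF} ≥ 1 − δ` only with probability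
`≤ e^{−t/2} + P̃_R{W ≥ ⟨W⟩_R̃ + t/2}/(1 − δ)` — i.e., typically `ΔF̂_N = −log Ẑ_N > ΔF − log(1 − δ)`
(Chatterjee–Diaconis Thm 1.1, second display, on path space). -/
theorem jarzynski_sampleSize_necessary (S : Fin (n + 1) → X → ℝ) (P : Fin n → X → X → ℝ)
    (hProw : ∀ k x, ∑ y, P k x y = 1) (hPpos : ∀ k x y, 0 < P k x y)
    (hst : ∀ k : Fin n, IsStationary (fun x => Real.exp (-(S k.succ x))) (P k))
    {t : ℝ} (ht : 0 ≤ t) {N : ℕ}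
    (hN : (N : ℝ) ≤ Real.exp ((freeEnergy (S (Fin.last n)) - freeEnergy (S 0)
      - ∑ ω, revPathLaw S P ω * work S ω) - t))
    {δ : ℝ} (hδ0 : 0 < δ) (hδ1 : δ < 1) :
    ((Measure.pi fun _ : Fin N => pathMeasure S P hProw hPpos)
        {x | 1 - δ ≤ (1 / (N : ℝ)) * ∑ i,
          Real.exp (-(work S (x i) - (freeEnergy (S (Fin.last n)) - freeEnergy (S 0))))}).toReal
      ≤ Real.exp (-t / 2)
        + (∑ ω, if (∑ ω', revPathLaw S P ω' * work S ω') + t / 2 ≤ work S ω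
            then revPathLaw S P ω else 0) / (1 - δ) := by
  have hR0 : ∀ ω, 0 ≤ revPathLaw S P ω := revPathLaw_nonneg S fun k x y => (hPpos k x y).le
  have hR1 : ∑ ω, revPathLaw S P ω = 1 := sum_revPathLaw S P hst
  have hkl := klFin_revPathLaw_pathLaw S P hPpos hst
  have h := finite_sampleSize_necessary (fun ω => pathLaw_pos (gibbsLaw_pos _) hPpos ω)
    (sum_pathLaw_gibbsLaw_eq_one S P hProw) hR0 hR1 ht (N := N) (by rwa [hkl]) hδ0 hδ1
  simp_rw [revPathLaw_div_pathLaw S P hPpos, Real.log_exp, hkl] at h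
  have hiff : ∀ ω, (-(work S ω - (freeEnergy (S (Fin.last n)) - freeEnergy (S 0)))
      ≤ freeEnergy (S (Fin.last n)) - freeEnergy (S 0) - ∑ ω', revPathLaw S P ω' * work S ω' - t / 2)
      ↔ ((∑ ω', revPathLaw S P ω' * work S ω') + t / 2 ≤ work S ω) := fun ω => by
    constructor <;> intro h <;> linarith
  simp_rw [hiff] at h
  exact h

/-- **JARZYNSKI / REWEIGHTING SAMPLE SIZE, SUFFICIENCY.**  For `N` INDEPENDENT forward evolutions
with `N ≥ exp(ΔF − ⟨W⟩_R̃ + t)` (`t ≥ 0`) and every path functional `f`: the Jarzynski-reweighted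
average `(1/N) Σ_i f(ωⁱ) e^{−(W_i − ΔF)}` estimates the reverse-path expectation `⟨f⟩_R̃` with
`E|error| ≤ √⟨f²⟩_R̃ · (e^{−t/4} + 2·√(P̃_R{W < ⟨W⟩_R̃ − t/2}))` (Chatterjee–Diaconis Thm 1.1, first
display, on path space). -/
theorem jarzynski_sampleSize_sufficient (S : Fin (n + 1) → X → ℝ) (P : Fin n → X → X → ℝ)
    (hProw : ∀ k x, ∑ y, P k x y = 1) (hPpos : ∀ k x y, 0 < P k x y)
    (hst : ∀ k : Fin n, IsStationary (fun x => Real.exp (-(S k.succ x))) (P k))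
    (f : (Fin (n + 1) → X) → ℝ) {t : ℝ} (ht : 0 ≤ t) {N : ℕ}
    (hN : Real.exp ((freeEnergy (S (Fin.last n)) - freeEnergy (S 0)
      - ∑ ω, revPathLaw S P ω * work S ω) + t) ≤ N) :
    ∫ x, |(1 / (N : ℝ)) * ∑ i, f (x i)
          * Real.exp (-(work S (x i) - (freeEnergy (S (Fin.last n)) - freeEnergy (S 0))))
        - ∑ ω, revPathLaw S P ω * f ω| ∂(Measure.pi fun _ : Fin N => pathMeasure S P hProw hPpos)
      ≤ Real.sqrt (∑ ω, revPathLaw S P ω * f ω ^ 2) *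
          (Real.exp (-t / 4) + 2 * Real.sqrt
            (∑ ω, if work S ω < (∑ ω', revPathLaw S P ω' * work S ω') - t / 2
              then revPathLaw S P ω else 0)) := by
  have hR0 : ∀ ω, 0 ≤ revPathLaw S P ω := revPathLaw_nonneg S fun k x y => (hPpos k x y).le
  have hR1 : ∑ ω, revPathLaw S P ω = 1 := sum_revPathLaw S P hst
  have hkl := klFin_revPathLaw_pathLaw S P hPpos hst
  have h := finite_sampleSize_sufficient (fun ω => pathLaw_pos (gibbsLaw_pos _) hPpos ω)
    (sum_pathLaw_gibbsLaw_eq_one S P hProw) hR0 hR1 f ht (N := N) (by rwa [hkl])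
  simp_rw [revPathLaw_div_pathLaw S P hPpos, Real.log_exp, hkl] at h
  have hiff : ∀ ω, (freeEnergy (S (Fin.last n)) - freeEnergy (S 0)
      - ∑ ω', revPathLaw S P ω' * work S ω' + t / 2
        < -(work S ω - (freeEnergy (S (Fin.last n)) - freeEnergy (S 0))))
      ↔ (work S ω < (∑ ω', revPathLaw S P ω' * work S ω') - t / 2) := fun ω => by
    constructor <;> intro h <;> linarith
  simp_rw [hiff] at h
  exact h

end Jarzynski

end Summit.Ventures.LatticeQCDFlow.Theory2
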